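import Summits.QuantumFields.YangMills.Theorems.BalabanUVNodesN15FullPropagatorSizedRecord
import Summits.QuantumFields.YangMills.Theorems.BalabanUVNodesN15TwoGridEntry0
import HarnessLib

/-!
# Route «BalabanUVNodes», cluster K4 «SpineRates» — node N15 = NE2: R3 — THE KERNEL NON-VANISHING LETTER OF THE SIZED GENUINE FAMILY
# (`tgFamilyS d hL b ν μ ≠` the zero kernel family; an `NE2Objects₁₁` with all operator kernels zero is NOT `fullGSizedObjects …`; the body of the
# K3⁷ v2 pin `N15PinnedSized 𝔯` FAILS for every reading whose operator kernels vanish at one tuple) — W-SEAT-START-LIST v7 §n15 l.180, dag-lead DEDUP-363 (d)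

Cell `pub-ymgap`, WIDTH SEAT `pub-ymgap-dag-n15-w1` (HUMAN RULING D-0149), generation 0, file R3.  Filed `--kind proof --supports stmt-QuantumFields-20544 --as helper` —
COUNT-NEUTRAL; theorems only (0 `def`, 0 `sorry`); imports dag-n15-a's part S-C `…N15FullPropagatorSizedRecord` (`fullGSizedObjects`, `tgFamilyS`, parts 55∕72∕82) and part 49
`…N15TwoGridEntry0` (`landauRe`, `deltaOp_eq`); nothing in the tree is modified or re-declared.

WHY.  K3⁷ v2 OF RECORD (plan g80, `D79-K3V2/K3Skeleton13SepCoPHv2.lean` 145a664ea9c38a7b, (A3-iii)) cures dag-n15-w2's R3 finding (p588191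
`PairedFamilyGuard.exists_reading_keyedLive_n15At_zeroKernels`: a reading with ALL THREE KERNEL FAMILIES ZERO passes `KeyedLive` and carries `N15At`) by the BY-NAME pin
`N15PinnedSized 𝔯 := ∃ b a_S ν μ α β c₃₅ p, 0 < b ∧ 0 < a_S ∧ ∀ F θ hP g₀ os k, (𝔯.lit F θ hP g₀ os).ne2 k = fullGSizedObjects 3 F.hL b a_S ν μ α β c₃₅ p` — and records «by-name
disproof pending a kernel non-vanishing letter from the n15 lanes».  THIS FILE IS THAT LETTER: Bałaban's genuine `U ≡ 1` two-grid defect `𝔇(G′, G) = G′P − PG` of the pair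
`(G′, G) = (Δ′_a⁻¹, Δ_a⁻¹)` (entry 0 of parts 55∕72∕82's operator family) is NOT the zero operator at any index with a genuine scale shift `m ≥ 1` — so `tgFamilyS d hL b ν μ` is not
the zero kernel family, an `NE2Objects₁₁` literal whose operator kernels all vanish is not `fullGSizedObjects …`, and the pin's body fails for every reading whose operator kernels
vanish at ONE tuple (`not_sizedPin_of_kop_zero`; v2 §4's missing R3 clause is two lines from it).

THE MATHEMATICS (exact algebra, no estimate).  Suppose `G′P = PG` (`P = pull kingPrV`, King's pull-back of coarse 1-forms).  Since `GΔ_a = 1` and `Δ′_aG′ = 1` (part 39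
`gOp_comp_deltaOp`, `deltaOp_comp_gOp`), `PΔ_a = Δ′_aP` (`pull_deltaOp_eq_of_intertwine`).  Test this on the coarse 1-form `μ(x, ν₀) = [x_ρ = 0]`, all other components `0`,
with two distinct directions `ρ ≠ ν₀` (`d ≥ 1`).  Its prolongation `Pμ` is constant along every bond's own direction, so `∂*(Pμ) = 0` termwise and the LANDAU TERM of part 49's
dictionary `Δ′_a = ρ(sLap) − ∂Π∂* + aQ′*Q′` (`deltaOp_eq`) kills it (`landauRe_eq_zero_of_longitudinal`, through b05's `GradOp_conjTranspose_mulVec_eq` ∕ `divS_apply`); the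
AVERAGING TERM `aQ′*Q′(Pμ)` takes the SAME value at the fine points `0` and `e_ρ` (same unit block, same `ν₀`-coordinate ⇒ the same line weights `θ_{n′}(·, z; ν₀)` of part 20 —
`qvAdjRe_apply_eq_of_sameBlock`); and `P(Δ_aμ)` takes the same value there too (`pr e_ρ = pr 0`, `L^m ≥ 2`).  But the fine LAPLACIAN of the cell-wise constant `Pμ` is `n′²` at
the cell boundary point `0` and `0` at the interior point `e_ρ` (`L^m ≥ 3`, automatic for `L` odd `> 1`, `m ≥ 1`) — contradiction (`exists_twoGridDefect_apply_ne_zero`).  At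
`m = 0` the defect IS zero (fine = coarse), so «some index» is the right quantifier for the family; the letter holds at EVERY index with `m ≥ 1` and for ANY entries 1–2.

WHAT.  §1 four exact two-grid facts (`landauRe_eq_zero_of_longitudinal`, `symbOp_sLap_apply`, `lineWeight_eq_of_sameBlock` ∕ `qvAdjRe_apply_eq_of_sameBlock`,
`pull_deltaOp_eq_of_intertwine`); §2 ★★ `exists_twoGridDefect_apply_ne_zero` (`d ≥ 1`, `L ≥ 3`, `k, m ≥ 1`, `a > 0`), ★ `exists_tgFamily_e_ne_zero` (part 55's family, any
`T1 T2`); §3 ★ `exists_tgFamilyS_e_ne_zero`, ★★ `tgFamilyS_ne_zero`, `fullGSizedObjects_kop_ne_zero`, ★★ `ne_fullGSizedObjects_of_kop_zero`; §4 (`d + 1 = 4`, a datum family's block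
factor, any `N`) `tgFamilyS_ne_zero_family`, `ne_fullGSizedObjects_of_kop_zero_family`, ★★★ `not_sizedPin_of_kop_zero` (reading level), `exists_kop_ne_zero_of_sizedPin`.

HONEST FRAMING.  Helper lane, count-neutral.  An exact algebraic letter about Bałaban's genuine `U ≡ 1` MODEL objects (the NON-DEGENERACY of the v2 pin's target), no
estimate, no datum content; nothing of Bałaban's analysis is asserted; NE2⁺ NOT PRINTED ∕ NOT PROVED; N15 NOT discharged (typed 28∕28 · discharged 5∕27, A 5∕28 of record
UNMOVED); K3⁷ OPEN, not claimed; the pin stays MODEL LEVEL (dag-lead's rule: no node discharge by a model pin).  The Yang–Mills mass gap (Clay) is NOT proved by any of this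
— R4 closes the conditional finite-𝕋⁴ rung `BalabanLadder.UV` only; nothing continuum ∕ ℝ⁴ ∕ OS ∕ infinite volume.  Restate-immune (no Theses import).
-/

set_option autoImplicit false

namespace Summit.QuantumFields.YangMills.BalabanUVNodes.N15.SizedNonVanishing

open Finset
open Literature.MathematicalPhysics.QuantumFieldTheory.Balaban1983to89
open Literature.MathematicalPhysics.QuantumFieldTheory.Balaban1983to89.B5Prop11Plancherel (Tor fine unitVec)
open Literature.MathematicalPhysics.QuantumFieldTheory.Balaban1983to89.B5Block118 (tstep)
open Literature.MathematicalPhysics.QuantumFieldTheory.Balaban1983to89.B5Action121 (GradOp divS divS_apply GradOp_conjTranspose_mulVec_eq)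
open Literature.MathematicalPhysics.QuantumFieldTheory.Balaban1983to89.B5Value126 (PcT)
open Literature.MathematicalPhysics.QuantumFieldTheory.Balaban1983to89.B5RealFields (reM)
open Literature.MathematicalPhysics.QuantumFieldTheory.Balaban1983to89.T4EtaRateDefect (idef idef_apply)
open Literature.MathematicalPhysics.QuantumFieldTheory.Balaban1983to89.T4EtaRateCoeffDefect (pull pull_apply)
open Literature.MathematicalPhysics.QuantumFieldTheory.Balaban1983to89.B11SectG (BlockNorm)
open Literature.MathematicalPhysics.QuantumFieldTheory.Balaban1983to89.B11AxialTransport190 (abs_le_loc_ofBlocks)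
open Literature.MathematicalPhysics.QuantumFieldTheory.Balaban1983to89.B6UnitTorusCarrier (unitTorusGeo)
open Literature.MathematicalPhysics.QuantumFieldTheory.Balaban1983to89.T4Continuum (T4Family ULoop)
open Literature.MathematicalPhysics.QuantumFieldTheory.King1986.Torus (blockOf val_blockOf)
open Summit.QuantumFields.YangMills.BalabanUVNodes.N15.TwoGrid (symbOp sT sA sLap sLapDir symbOp_sLapDir_apply gOp deltaOp gOp_comp_deltaOp deltaOp_comp_gOp
  landauRe deltaOp_eq reM_mulVec_apply qvRe qvAdjRe qvAdjRe_apply tstep_eq_smul TGIndex tgFamily tgOps tgT1 tgT2)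
open Summit.QuantumFields.YangMills.BalabanUVNodes.N15.VectorPiece (kingPr kingPrV kingPr_val kingPrV_eq lineWeight)
open Summit.QuantumFields.YangMills.BalabanUVNodes.N15.GenuineRecord (TGIndexS tgFamilyS fullGSizedObjects)
open Summit.QuantumFields.YangMills.BalabanUVNodes.N15.AtKeyedHome (neZero_blockFactor)
open Node00 (Stage13HParams NE2Objects₁₁)
open YMDAG.UVSplit (RateReading₁₃CoPH)

variable {d : ℕ}

/-! ## §1 Four exact two-grid facts: the Landau term on longitudinally constant 1-forms, the Laplacian pointwise, the line weights across a block, the intertwining -/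

section TwoGridFacts

variable (M : Fin (d + 1) → ℕ) [∀ μ, NeZero (M μ)] (n : ℕ) [NeZero n]

/-- **THE LANDAU TERM KILLS LONGITUDINALLY CONSTANT 1-FORMS**: if every component `f(·, a)` is invariant under the backward unit shift in its OWN direction `a`, then the
divergence `∂*f = Σ_a ∂_a^* f_a` vanishes termwise, hence `Vf = ∂Π∂*f = 0` (part 49's `landauRe = mulVecLin (Re(∂·Π·∂ᴴ))`, b05's `∂ᴴ = ∂*` `GradOp_conjTranspose_mulVec_eq`).
[cite: Balaban1984PropagatorsI, (1.21) p.21 (∂*), (1.69) p.29 (the term ∂P∂* of Δ_a)] -/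
theorem landauRe_eq_zero_of_longitudinal (f : Tor (fine n M) × Fin (d + 1) → ℝ)
    (hf : ∀ (x : Tor (fine n M)) (a : Fin (d + 1)), f (x - unitVec (fine n M) a, a) = f (x, a)) : landauRe M n f = 0 := by
  have hdiv : Matrix.mulVec (GradOp (fine n M) (n : ℂ)).conjTranspose (fun j : Tor (fine n M) × Fin (d + 1) => ((f j : ℝ) : ℂ)) = 0 := by
    rw [GradOp_conjTranspose_mulVec_eq]
    funext x
    rw [divS_apply, Pi.zero_apply]
    exact sum_eq_zero fun a _ => by simp only [hf x a, sub_self, mul_zero]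
  refine funext fun i => ?_
  show Matrix.mulVecLin (reM (GradOp (fine n M) (n : ℂ) * PcT n M (n : ℂ) * (GradOp (fine n M) (n : ℂ)).conjTranspose)) f i = 0
  rw [Matrix.mulVecLin_apply, reM_mulVec_apply, ← Matrix.mulVec_mulVec, hdiv, Matrix.mulVec_zero, Pi.zero_apply, Complex.zero_re]

omit [∀ μ, NeZero (M μ)] [NeZero n] in
/-- THE LATTICE LAPLACIAN `ρ(sLap c)`, POINTWISE: `Σ_ν c²(2f(x, a) − f(x + e_ν, a) − f(x − e_ν, a))` (part 42's directional formula summed). [cite: Balaban1984PropagatorsI, (1.21) p.21] -/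
theorem symbOp_sLap_apply (c : ℝ) (f : Tor (fine n M) × Fin (d + 1) → ℝ) (x : Tor (fine n M)) (a : Fin (d + 1)) :
    symbOp M n (sLap M n c) f (x, a) =
      ∑ ν : Fin (d + 1), c ^ 2 * (2 * f (x, a) - f (x + unitVec (fine n M) ν, a) - f (x - unitVec (fine n M) ν, a)) := by
  rw [sLap, map_sum, LinearMap.sum_apply, Finset.sum_apply]
  exact sum_congr rfl fun ν _ => symbOp_sLapDir_apply M n ν c f (x, a)

/-- **THE LINE WEIGHTS DO NOT SEE TRANSVERSE MOVES INSIDE A BLOCK**: two fine points in the SAME unit block with the SAME `κ`-coordinate have the same line weights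
`θ_n(·, z; κ)` (part 20: `θ_n(x, z; κ) = #{t < n : B(x − te_κ) = z}∕n` — the blocks `B(x − te_κ)` agree coordinatewise). [cite: Balaban1984PropagatorsI, (1.18) p.20] -/
theorem lineWeight_eq_of_sameBlock (κ : Fin (d + 1)) {x y : Tor (fine n M)} (hb : blockOf n M x = blockOf n M y) (hκ : x κ = y κ) (z : Tor M) :
    lineWeight n M κ x z = lineWeight n M κ y z := by
  have key : ∀ t : ℕ, blockOf n M (x - tstep (fine n M) κ t) = blockOf n M (y - tstep (fine n M) κ t) := by
    intro t
    funext c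
    apply ZMod.val_injective
    rw [val_blockOf, val_blockOf]
    by_cases hc : c = κ
    · rw [hc, Pi.sub_apply, Pi.sub_apply, hκ]
    · have hv : ∀ w : Tor (fine n M), (w - tstep (fine n M) κ t) c = w c := fun w => by
        rw [Pi.sub_apply, tstep_eq_smul, Pi.smul_apply, unitVec, Pi.single_eq_of_ne hc, smul_zero, sub_zero]
      have hbc := congrArg (fun w : Tor M => (w c).val) hb
      simp only [val_blockOf] at hbc
      rw [hv, hv, hbc]
  unfold lineWeight
  simp_rw [key]

/-- … HENCE `Q*v` TAKES THE SAME VALUE AT SUCH POINTS (part 37's `(Q*v)(x, κ) = Σ_z θ_n(x, z; κ)v(z, κ)`). [cite: Balaban1984PropagatorsI, (1.18) p.20, (1.69) p.29 (Q*)] -/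
theorem qvAdjRe_apply_eq_of_sameBlock (v : Tor M × Fin (d + 1) → ℝ) (κ : Fin (d + 1)) {x y : Tor (fine n M)} (hb : blockOf n M x = blockOf n M y)
    (hκ : x κ = y κ) : qvAdjRe M n v (x, κ) = qvAdjRe M n v (y, κ) := by
  rw [qvAdjRe_apply, qvAdjRe_apply]
  exact sum_congr rfl fun z _ => by rw [lineWeight_eq_of_sameBlock M n κ hb hκ z]

variable {L : ℕ} [NeZero L]

/-- **THE INTERTWINING**: if `G′P = PG` then `PΔ_a = Δ′_aP` (`G = Δ_a⁻¹`, `G′ = Δ′_a⁻¹`: `P(Δ_av) = Δ′_aG′P(Δ_av) = Δ′_aPGΔ_av = Δ′_a(Pv)`). [folklore] -/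
theorem pull_deltaOp_eq_of_intertwine (k m : ℕ) {a : ℝ} (ha : 0 < a)
    (h : gOp M (L ^ m * L ^ k) a ∘ₗ pull (kingPrV L k m M) = pull (kingPrV L k m M) ∘ₗ gOp M (L ^ k) a)
    (v : Tor (fine (L ^ k) M) × Fin (d + 1) → ℝ) :
    pull (kingPrV L k m M) (deltaOp M (L ^ k) a v) = deltaOp M (L ^ m * L ^ k) a (pull (kingPrV L k m M) v) := by
  have hL0 : L ≠ 0 := NeZero.ne L
  have hk1 : 1 ≤ L ^ k := Nat.one_le_iff_ne_zero.mpr (pow_ne_zero k hL0)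
  have hmk1 : 1 ≤ L ^ m * L ^ k := Nat.one_le_iff_ne_zero.mpr (mul_ne_zero (pow_ne_zero m hL0) (pow_ne_zero k hL0))
  have h1 : gOp M (L ^ m * L ^ k) a (pull (kingPrV L k m M) (deltaOp M (L ^ k) a v)) =
      pull (kingPrV L k m M) (gOp M (L ^ k) a (deltaOp M (L ^ k) a v)) := by
    simpa only [LinearMap.comp_apply] using LinearMap.congr_fun h (deltaOp M (L ^ k) a v)
  calc pull (kingPrV L k m M) (deltaOp M (L ^ k) a v)
      = deltaOp M (L ^ m * L ^ k) a (gOp M (L ^ m * L ^ k) a (pull (kingPrV L k m M) (deltaOp M (L ^ k) a v))) := by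
        rw [← LinearMap.comp_apply (deltaOp M (L ^ m * L ^ k) a) (gOp M (L ^ m * L ^ k) a), deltaOp_comp_gOp M (L ^ m * L ^ k) a hmk1 ha,
          LinearMap.id_apply]
    _ = deltaOp M (L ^ m * L ^ k) a (pull (kingPrV L k m M) v) := by
        rw [h1, ← LinearMap.comp_apply (gOp M (L ^ k) a) (deltaOp M (L ^ k) a) v, gOp_comp_deltaOp M (L ^ k) a hk1 ha, LinearMap.id_apply]

/-! ## §2 The two-grid defect `G′P − PG` of Bałaban's genuine pair `(Δ′_a⁻¹, Δ_a⁻¹)` is not the zero operator (`m ≥ 1`) -/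

/-- ★★ **`𝔇(G′, G) = G′P − PG ≠ 0`** for `d ≥ 1`, `L ≥ 3`, `k, m ≥ 1`, `a > 0`: there are a coarse 1-form `λ` and a fine bond `x′` with `(G′Pλ − PGλ)(x′) ≠ 0`.  Proof: the
intertwining `PΔ_a = Δ′_aP` it would force is refuted on `μ(x, ν₀) = [x_ρ = 0]` at the fine points `0`, `e_ρ` (module docstring: Landau term `0`, averaging term and `P(Δ_aμ)`
equal at the two points, fine Laplacian `n′²` vs `0`). [cite: Balaban1984PropagatorsI, (1.69) p.29, (1.73) p.30 (Δ_a = Δ − ∂P∂* + aQ*Q); King1986, p.664 (the pairing x′ ∈ B^n(x))] -/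
theorem exists_twoGridDefect_apply_ne_zero (hd : 1 ≤ d) (h3 : 3 ≤ L) (k m : ℕ) (hk : 1 ≤ k) (hm : 1 ≤ m) {a : ℝ} (ha : 0 < a) :
    ∃ (lam : Tor (fine (L ^ k) M) × Fin (d + 1) → ℝ) (x' : Tor (fine (L ^ m * L ^ k) M) × Fin (d + 1)),
      idef (pull (kingPrV L k m M)) (pull (kingPrV L k m M)) (gOp M (L ^ m * L ^ k) a) (gOp M (L ^ k) a) lam x' ≠ 0 := by
  by_contra H
  push Not at H
  -- the intertwining `G′P = PG`
  have hGP : gOp M (L ^ m * L ^ k) a ∘ₗ pull (kingPrV L k m M) = pull (kingPrV L k m M) ∘ₗ gOp M (L ^ k) a :=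
    LinearMap.ext fun lam => funext fun x' => sub_eq_zero.mp (by have h := H lam x'; rwa [idef_apply, Pi.sub_apply] at h)
  -- two distinct directions
  obtain ⟨ν₀, ρ, hρν⟩ : ∃ ν₀ ρ : Fin (d + 1), ρ ≠ ν₀ := ⟨⟨0, by omega⟩, ⟨1, by omega⟩, fun h => by simp [Fin.ext_iff] at h⟩
  have hνρ : ν₀ ≠ ρ := fun h => hρν h.symm
  -- sizes
  have hL0 : L ≠ 0 := by omega
  have hLm : 3 ≤ L ^ m := le_trans (Nat.le_self_pow (by omega) 3) (Nat.pow_le_pow_left h3 m)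
  have hLk : 3 ≤ L ^ k := le_trans (Nat.le_self_pow (by omega) 3) (Nat.pow_le_pow_left h3 k)
  have hM1 : 1 ≤ M ρ := Nat.one_le_iff_ne_zero.mpr (NeZero.ne (M ρ))
  have hN : L ^ m + 2 ≤ L ^ m * L ^ k * M ρ :=
    calc L ^ m + 2 ≤ L ^ m * 3 := by omega
      _ ≤ L ^ m * L ^ k := Nat.mul_le_mul_left _ hLk
      _ ≤ L ^ m * L ^ k * M ρ := Nat.le_mul_of_pos_right _ hM1
  have hLm0 : 0 < L ^ m := by omega
  -- the fine torus coordinates of `0`, `e_ρ`, `2e_ρ`, `−e_ρ` in direction `ρ`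
  have v0 : ((0 : Tor (fine (L ^ m * L ^ k) M)) ρ).val = 0 := ZMod.val_zero
  have v1 : ((unitVec (fine (L ^ m * L ^ k) M) ρ) ρ).val = 1 := by
    rw [unitVec, Pi.single_eq_same, ZMod.val_one_eq_one_mod, Nat.mod_eq_of_lt (show 1 < fine (L ^ m * L ^ k) M ρ from by show 1 < L ^ m * L ^ k * M ρ; omega)]
  have v2 : ((unitVec (fine (L ^ m * L ^ k) M) ρ + unitVec (fine (L ^ m * L ^ k) M) ρ) ρ).val = 2 := by
    rw [Pi.add_apply, ZMod.val_add_of_lt (by rw [v1]; show 1 + 1 < L ^ m * L ^ k * M ρ; omega), v1]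
  have vneg : ((0 - unitVec (fine (L ^ m * L ^ k) M) ρ : Tor (fine (L ^ m * L ^ k) M)) ρ).val = L ^ m * L ^ k * M ρ - 1 := by
    have h10 : (unitVec (fine (L ^ m * L ^ k) M) ρ) ρ ≠ 0 := fun h => by have := congrArg ZMod.val h; rw [v1, ZMod.val_zero] at this; exact one_ne_zero this
    rw [zero_sub, Pi.neg_apply, ZMod.neg_val, if_neg h10, v1]
  have vadd : ∀ (x' : Tor (fine (L ^ m * L ^ k) M)) (c : Fin (d + 1)), c ≠ ρ → (x' + unitVec (fine (L ^ m * L ^ k) M) c) ρ = x' ρ := fun x' c hc => by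
    rw [Pi.add_apply, unitVec, Pi.single_eq_of_ne (fun h => hc h.symm), add_zero]
  have vsub : ∀ (x' : Tor (fine (L ^ m * L ^ k) M)) (c : Fin (d + 1)), c ≠ ρ → (x' - unitVec (fine (L ^ m * L ^ k) M) c) ρ = x' ρ := fun x' c hc => by
    rw [Pi.sub_apply, unitVec, Pi.single_eq_of_ne (fun h => hc h.symm), sub_zero]
  -- the test 1-form `μ(x, ν₀) = [x_ρ = 0]` and its prolongation `f = Pμ`
  set μf : Tor (fine (L ^ k) M) × Fin (d + 1) → ℝ := fun i => if i.2 = ν₀ then (if i.1 ρ = 0 then 1 else 0) else 0 with hμf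
  have hdep : ∀ (x' y' : Tor (fine (L ^ m * L ^ k) M)) (c : Fin (d + 1)), x' ρ = y' ρ →
      pull (kingPrV L k m M) μf (x', c) = pull (kingPrV L k m M) μf (y', c) := by
    intro x' y' c h
    have hρ : kingPr L k m M x' ρ = kingPr L k m M y' ρ := by
      show ((((x' ρ).val / L ^ m : ℕ) : ZMod (fine (L ^ k) M ρ))) = (((y' ρ).val / L ^ m : ℕ) : ZMod (fine (L ^ k) M ρ))
      rw [h]
    show (if c = ν₀ then (if kingPr L k m M x' ρ = 0 then (1 : ℝ) else 0) else 0) =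
      if c = ν₀ then (if kingPr L k m M y' ρ = 0 then (1 : ℝ) else 0) else 0
    rw [hρ]
  have hfa : ∀ (x' : Tor (fine (L ^ m * L ^ k) M)) (c : Fin (d + 1)), c ≠ ν₀ → pull (kingPrV L k m M) μf (x', c) = 0 := by
    intro x' c hc
    simp only [hμf, pull_apply, kingPrV_eq, if_neg hc]
  have hfl : ∀ (x' : Tor (fine (L ^ m * L ^ k) M)) (c : Fin (d + 1)),
      pull (kingPrV L k m M) μf (x' - unitVec (fine (L ^ m * L ^ k) M) c, c) = pull (kingPrV L k m M) μf (x', c) := by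
    intro x' c
    by_cases hc : c = ν₀
    · rw [hc]; exact hdep _ _ _ (vsub x' ν₀ hνρ)
    · rw [hfa _ _ hc, hfa _ _ hc]
  have hP0 : ∀ x' : Tor (fine (L ^ m * L ^ k) M), kingPr L k m M x' ρ = 0 ↔ (x' ρ).val < L ^ m := by
    intro x'
    rw [← ZMod.val_eq_zero, kingPr_val]
    refine ⟨fun h => ?_, fun h => Nat.div_eq_of_lt h⟩
    by_contra hc
    have := Nat.div_pos (not_lt.mp hc) hLm0
    omega
  have hf1 : ∀ x' : Tor (fine (L ^ m * L ^ k) M), (x' ρ).val < L ^ m → pull (kingPrV L k m M) μf (x', ν₀) = 1 := by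
    intro x' h
    have h0 := (hP0 x').mpr h
    simp [hμf, kingPrV_eq, h0]
  have hf0 : ∀ x' : Tor (fine (L ^ m * L ^ k) M), L ^ m ≤ (x' ρ).val → pull (kingPrV L k m M) μf (x', ν₀) = 0 := by
    intro x' h
    have h0 : ¬ kingPr L k m M x' ρ = 0 := fun h' => absurd ((hP0 x').mp h') (not_lt.mpr h)
    simp [hμf, kingPrV_eq, h0]
  -- the Landau term kills `Pμ`; the averaging term agrees at `0` and `e_ρ`
  have hV := landauRe_eq_zero_of_longitudinal M (L ^ m * L ^ k) (pull (kingPrV L k m M) μf) hfl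
  have hblk : blockOf (L ^ m * L ^ k) M (0 : Tor (fine (L ^ m * L ^ k) M)) = blockOf (L ^ m * L ^ k) M (unitVec (fine (L ^ m * L ^ k) M) ρ) := by
    funext c
    apply ZMod.val_injective
    rw [val_blockOf, val_blockOf]
    by_cases hc : c = ρ
    · have h9 : 3 * 3 ≤ L ^ m * L ^ k := Nat.mul_le_mul hLm hLk
      rw [hc, v1, Pi.zero_apply, ZMod.val_zero, Nat.zero_div, Nat.div_eq_of_lt (by omega)]
    · rw [Pi.zero_apply, unitVec, Pi.single_eq_of_ne hc]
  have hν : (0 : Tor (fine (L ^ m * L ^ k) M)) ν₀ = (unitVec (fine (L ^ m * L ^ k) M) ρ) ν₀ := by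
    rw [Pi.zero_apply, unitVec, Pi.single_eq_of_ne hνρ]
  have hQ := qvAdjRe_apply_eq_of_sameBlock M (L ^ m * L ^ k) (qvRe M (L ^ m * L ^ k) (pull (kingPrV L k m M) μf)) ν₀ hblk hν
  -- the fine Laplacian of the cell-wise constant `Pμ`: `n′²` at `0`, `0` at `e_ρ`
  have lap0 : symbOp M (L ^ m * L ^ k) (sLap M (L ^ m * L ^ k) ((L ^ m * L ^ k : ℕ) : ℝ)) (pull (kingPrV L k m M) μf)
      ((0 : Tor (fine (L ^ m * L ^ k) M)), ν₀) = ((L ^ m * L ^ k : ℕ) : ℝ) ^ 2 := by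
    rw [symbOp_sLap_apply, Finset.sum_eq_single ρ]
    · rw [hf1 0 (by rw [v0]; exact hLm0), hf1 _ (by rw [zero_add, v1]; omega), hf0 _ (by rw [vneg]; omega)]
      ring
    · intro c _ hc
      rw [hdep _ 0 ν₀ (vadd 0 c hc), hdep _ 0 ν₀ (vsub 0 c hc)]
      ring
    · exact fun h => absurd (Finset.mem_univ ρ) h
  have lap1 : symbOp M (L ^ m * L ^ k) (sLap M (L ^ m * L ^ k) ((L ^ m * L ^ k : ℕ) : ℝ)) (pull (kingPrV L k m M) μf)
      (unitVec (fine (L ^ m * L ^ k) M) ρ, ν₀) = 0 := by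
    rw [symbOp_sLap_apply]
    refine Finset.sum_eq_zero fun c _ => ?_
    by_cases hc : c = ρ
    · rw [hc, hf1 _ (by rw [v1]; omega), hf1 _ (by rw [v2]; omega), sub_self, hf1 0 (by rw [v0]; exact hLm0)]
      ring
    · rw [hdep _ (unitVec (fine (L ^ m * L ^ k) M) ρ) ν₀ (vadd _ c hc), hdep _ (unitVec (fine (L ^ m * L ^ k) M) ρ) ν₀ (vsub _ c hc)]
      ring
  -- the intertwining evaluated at `0` and `e_ρ`: `P(Δ_aμ)` agrees there, so `Δ′_a(Pμ)` does
  have key := pull_deltaOp_eq_of_intertwine M k m ha hGP μf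
  have hK : kingPr L k m M (unitVec (fine (L ^ m * L ^ k) M) ρ) = kingPr L k m M 0 := by
    funext c
    show ((((unitVec (fine (L ^ m * L ^ k) M) ρ) c).val / L ^ m : ℕ) : ZMod (fine (L ^ k) M c)) =
      ((((0 : Tor (fine (L ^ m * L ^ k) M)) c).val / L ^ m : ℕ) : ZMod (fine (L ^ k) M c))
    by_cases hc : c = ρ
    · rw [hc, v1, Pi.zero_apply, ZMod.val_zero, Nat.zero_div, Nat.div_eq_of_lt (by omega)]
    · rw [unitVec, Pi.single_eq_of_ne hc, Pi.zero_apply]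
  have hPΔ : pull (kingPrV L k m M) (deltaOp M (L ^ k) a μf) ((0 : Tor (fine (L ^ m * L ^ k) M)), ν₀) =
      pull (kingPrV L k m M) (deltaOp M (L ^ k) a μf) (unitVec (fine (L ^ m * L ^ k) M) ρ, ν₀) := by
    simp only [pull_apply, kingPrV_eq, hK]
  rw [key, deltaOp_eq] at hPΔ
  simp only [LinearMap.sub_apply, LinearMap.add_apply, LinearMap.smul_apply, LinearMap.coe_comp, Function.comp_apply, Pi.add_apply, Pi.smul_apply,
    smul_eq_mul, hV, sub_zero, hQ, lap0, lap1, add_left_inj] at hPΔ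
  have hn' : (0 : ℝ) < ((L ^ m * L ^ k : ℕ) : ℝ) := by exact_mod_cast Nat.pos_of_ne_zero (mul_ne_zero (pow_ne_zero m hL0) (pow_ne_zero k hL0))
  exact absurd hPΔ (pow_pos hn' 2).ne'

/-- ★ **ENTRY 0 OF THE REALISED TWO-GRID FAMILY IS NOT THE ZERO KERNEL** at every index of the torus family of record with a genuine scale shift `m ≥ 1` — for Bałaban's pair
`(Δ′_a⁻¹, Δ_a⁻¹)`, `a > 0`, odd `L > 1`, `d ≥ 1`, and ANY entries 1–2 `T1, T2` (part 55's `tgFamily`): some test 1-form `λ` and some fine cube `y` have `e 0 () λ y ≠ 0` (the entry is the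
sup over the cube of `|(G′P − PG)λ|`, which dominates the non-zero value of §2). [cite: Balaban1985BackgroundPropagators, (3.42) p.397 (the entry: shape); Balaban1984PropagatorsI, (1.69) p.29] -/
theorem exists_tgFamily_e_ne_zero (hd : 1 ≤ d) (hL : Odd L ∧ 1 < L) {a : ℝ} (ha : 0 < a)
    (T1 T2 : ∀ i : TGIndex, (Tor (fine (L ^ i.k) (TGIndex.Mn d hL i)) × Fin (d + 1) → ℝ) →ₗ[ℝ]
      (Tor (fine (L ^ i.m * L ^ i.k) (TGIndex.Mn d hL i)) × Fin (d + 1) → ℝ))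
    (i : TGIndex) (hi : 1 ≤ i.m) : ∃ lam y, (tgFamily d hL a T1 T2 i).e 0 () lam y ≠ 0 := by
  have h3 : 3 ≤ L := by obtain ⟨r, hr⟩ := hL.1; omega
  obtain ⟨lam, x', hne⟩ := exists_twoGridDefect_apply_ne_zero (TGIndex.Mn d hL i) hd h3 i.k i.m i.one_le hi ha
  refine ⟨lam, blockOf (L ^ i.m * L ^ i.k) (TGIndex.Mn d hL i) x'.1, fun h0 => hne ?_⟩
  have hle := abs_le_loc_ofBlocks (g := unitTorusGeo L i.k (TGIndex.Mn d hL i))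
    (fun j : Tor (fine (L ^ i.m * L ^ i.k) (TGIndex.Mn d hL i)) × Fin (d + 1) => blockOf (L ^ i.m * L ^ i.k) (TGIndex.Mn d hL i) j.1)
    (idef (pull (kingPrV L i.k i.m (TGIndex.Mn d hL i))) (pull (kingPrV L i.k i.m (TGIndex.Mn d hL i)))
      (gOp (TGIndex.Mn d hL i) (L ^ i.m * L ^ i.k) a) (gOp (TGIndex.Mn d hL i) (L ^ i.k) a) lam) (x' := x') rfl
  have h0' : (BlockNorm.ofBlocks (unitTorusGeo L i.k (TGIndex.Mn d hL i))
      (fun j : Tor (fine (L ^ i.m * L ^ i.k) (TGIndex.Mn d hL i)) × Fin (d + 1) => blockOf (L ^ i.m * L ^ i.k) (TGIndex.Mn d hL i) j.1)).loc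
      (blockOf (L ^ i.m * L ^ i.k) (TGIndex.Mn d hL i) x'.1)
      (idef (pull (kingPrV L i.k i.m (TGIndex.Mn d hL i))) (pull (kingPrV L i.k i.m (TGIndex.Mn d hL i)))
        (gOp (TGIndex.Mn d hL i) (L ^ i.m * L ^ i.k) a) (gOp (TGIndex.Mn d hL i) (L ^ i.k) a) lam) = 0 := h0
  rw [h0'] at hle
  exact abs_eq_zero.mp (le_antisymm hle (abs_nonneg _))

end TwoGridFacts

/-! ## §3 The sized genuine family and its `NE2Objects₁₁` literal: not the zero kernels -/

section Sized

variable {L : ℕ} [NeZero L]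

/-- ★ **THE SIZED GENUINE OPERATOR FAMILY HAS A NON-ZERO ENTRY** at every sized index with `m ≥ 1` (`b > 0`, `d ≥ 1`): part 82's `tgFamilyS d hL b ν μ j` is part 72's honest family
at `j.toTGIndex` VERBATIM, so §2 applies. [cite: Balaban1985BackgroundPropagators, (3.42) p.397 (shape)] -/
theorem exists_tgFamilyS_e_ne_zero (hd : 1 ≤ d) (hL : Odd L ∧ 1 < L) {b : ℝ} (hb : 0 < b) (ν μ : Fin (d + 1)) (j : TGIndexS) (hj : 1 ≤ j.m) :
    ∃ lam y, (tgFamilyS d hL b ν μ j).e 0 () lam y ≠ 0 :=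
  exists_tgFamily_e_ne_zero hd hL hb (tgT1 d hL b ν) (tgT2 d hL b μ) j.toTGIndex hj

/-- ★★ **R3 — THE KERNEL NON-VANISHING LETTER**: the sized genuine operator kernel family is NOT the zero kernel family (`b > 0`, `d ≥ 1`, odd `L > 1`; witness index
`(m_T, k, m, M) = (1, 1, 1, 1)`). [cite: Balaban1985BackgroundPropagators, (3.42) p.397 (shape)] -/
theorem tgFamilyS_ne_zero (hd : 1 ≤ d) (hL : Odd L ∧ 1 < L) {b : ℝ} (hb : 0 < b) (ν μ : Fin (d + 1)) :
    tgFamilyS d hL b ν μ ≠ fun _ => ⟨0, 0, 0, 0, 0, 0⟩ := by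
  intro h
  obtain ⟨lam, y, hne⟩ := exists_tgFamilyS_e_ne_zero hd hL hb ν μ ⟨⟨1, 1, le_rfl, 1⟩, le_rfl, 1, le_rfl⟩ le_rfl
  exact hne (by rw [h]; rfl)

/-- The `NE2Objects₁₁` literal of the sized genuine family (part S-C `fullGSizedObjects`) does NOT carry the zero operator kernels. [bookkeeping] -/
theorem fullGSizedObjects_kop_ne_zero (hd : 1 ≤ d) (hL : Odd L ∧ 1 < L) {b : ℝ} (hb : 0 < b) (aS : ℝ) (ν μ α β : Fin (d + 1)) (c35 p : ℝ) :
    (fullGSizedObjects d hL b aS ν μ α β c35 p).Kop ≠ fun _ => ⟨0, 0, 0, 0, 0, 0⟩ :=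
  tgFamilyS_ne_zero hd hL hb ν μ

/-- ★★ **THE ZERO-KERNEL EXCLUSION, OBJECT LEVEL**: an `NE2Objects₁₁` literal ALL of whose operator kernels vanish (`∀ i n U λ y, (o.Kop i).e n U λ y = 0` — dag-n15-w2's
p588191 reading is built from such objects) is NOT `fullGSizedObjects d hL b a_S ν μ α β c₃₅ p` (`b > 0`, `d ≥ 1`). [bookkeeping] -/
theorem ne_fullGSizedObjects_of_kop_zero (hd : 1 ≤ d) (hL : Odd L ∧ 1 < L) {b : ℝ} (hb : 0 < b) (aS : ℝ) (ν μ α β : Fin (d + 1)) (c35 p : ℝ)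
    (o : NE2Objects₁₁) (hz : ∀ i n U lam y, (o.Kop i).e n U lam y = 0) : o ≠ fullGSizedObjects d hL b aS ν μ α β c35 p := by
  rintro rfl
  obtain ⟨lam, y, hne⟩ := exists_tgFamilyS_e_ne_zero hd hL hb ν μ ⟨⟨1, 1, le_rfl, 1⟩, le_rfl, 1, le_rfl⟩ le_rfl
  exact hne (hz ⟨⟨1, 1, le_rfl, 1⟩, le_rfl, 1, le_rfl⟩ 0 () lam y)

end Sized

/-! ## §4 Reading level (`d + 1 = 4`, any `N`): the body of the K3⁷ v2 pin `N15PinnedSized` fails for every reading whose operator kernels vanish at one tuple -/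

section Reading

variable {N : ℕ} [NeZero N]

/-- **R3 FOR THE PLAN's LITERAL** `tgFamilyS 3 F.hL b ν μ` (W-SEAT-START-LIST v7 §n15 l.180): on a datum family's own block factor (`Odd F.L ∧ 1 < F.L` IS `F.hL`) the sized
genuine operator kernel family is not the zero kernel family (`b > 0`). [bookkeeping] -/
theorem tgFamilyS_ne_zero_family (F : T4Family) {b : ℝ} (hb : 0 < b) (ν μ : Fin 4) :
    haveI := neZero_blockFactor F; tgFamilyS 3 F.hL b ν μ ≠ fun _ => ⟨0, 0, 0, 0, 0, 0⟩ := by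
  haveI := neZero_blockFactor F
  exact tgFamilyS_ne_zero (d := 3) (by norm_num) F.hL hb ν μ

/-- The object-level exclusion on a datum family's block factor: an `NE2Objects₁₁` literal with all operator kernels zero is not `fullGSizedObjects 3 F.hL b a_S ν μ α β c₃₅ p`
(`b > 0`). [bookkeeping] -/
theorem ne_fullGSizedObjects_of_kop_zero_family (F : T4Family) {b : ℝ} (hb : 0 < b) (aS : ℝ) (ν μ α β : Fin 4) (c35 p : ℝ) (o : NE2Objects₁₁)
    (hz : ∀ i n U lam y, (o.Kop i).e n U lam y = 0) : o ≠ haveI := neZero_blockFactor F; fullGSizedObjects 3 F.hL b aS ν μ α β c35 p := by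
  haveI := neZero_blockFactor F
  exact ne_fullGSizedObjects_of_kop_zero (d := 3) (by norm_num) F.hL hb aS ν μ α β c35 p o hz

/-- ★★★ **R3 AT THE READING — THE ZERO-KERNEL READING IS OFF THE PIN**: for ANY Stage-13 rate reading `𝔯` and ANY tuple `(F, θ, hP, g₀, os, k)` at which ALL operator kernels
of `(𝔯.lit F θ hP g₀ os).ne2 k` vanish, the BODY of plan g80's v2 pin `N15PinnedSized 𝔯` (with `2 ↦ N`) is FALSE: there are no `b, a_S > 0`, `ν μ α β`, `c₃₅`, `p` with
`(𝔯.lit F θ hP g₀ os).ne2 k = fullGSizedObjects 3 F.hL b a_S ν μ α β c₃₅ p` at every tuple.  With dag-n15-w2's p588191 (`exists_reading_keyedLive_n15At_zeroKernels`: kernels zero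
at EVERY tuple, `KeyedLive` and `N15At` nevertheless) this is v2 §4's missing R3 clause, given one tuple. [bookkeeping] -/
theorem not_sizedPin_of_kop_zero (𝔯 : RateReading₁₃CoPH N) {F : T4Family} {θ : Stage13HParams F N} {hP : θ.Provisos₁₃CoPH F N} {g₀ : ℕ → ℝ}
    {os : List (ULoop F)} {k : ℕ} (hz : ∀ i n U lam y, ((((𝔯.lit F θ hP g₀ os).ne2 k).Kop i).e n U lam y) = 0) :
    ¬ ∃ (b aS : ℝ) (ν μ α β : Fin 4) (c35 p : ℝ), 0 < b ∧ 0 < aS ∧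
        ∀ (F : T4Family) (θ : Stage13HParams F N) (hP : θ.Provisos₁₃CoPH F N) (g₀ : ℕ → ℝ) (os : List (ULoop F)) (k : ℕ),
          (𝔯.lit F θ hP g₀ os).ne2 k = haveI := neZero_blockFactor F; fullGSizedObjects 3 F.hL b aS ν μ α β c35 p := by
  rintro ⟨b, aS, ν, μ, α, β, c35, p, hb, -, hpin⟩
  exact ne_fullGSizedObjects_of_kop_zero_family F hb aS ν μ α β c35 p _ hz (hpin F θ hP g₀ os k)

/-- … EQUIVALENTLY: a reading ON the pin has, at EVERY tuple and run length, an operator kernel entry that does not vanish. [bookkeeping] -/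
theorem exists_kop_ne_zero_of_sizedPin (𝔯 : RateReading₁₃CoPH N)
    (hpin : ∃ (b aS : ℝ) (ν μ α β : Fin 4) (c35 p : ℝ), 0 < b ∧ 0 < aS ∧
        ∀ (F : T4Family) (θ : Stage13HParams F N) (hP : θ.Provisos₁₃CoPH F N) (g₀ : ℕ → ℝ) (os : List (ULoop F)) (k : ℕ),
          (𝔯.lit F θ hP g₀ os).ne2 k = haveI := neZero_blockFactor F; fullGSizedObjects 3 F.hL b aS ν μ α β c35 p)
    (F : T4Family) (θ : Stage13HParams F N) (hP : θ.Provisos₁₃CoPH F N) (g₀ : ℕ → ℝ) (os : List (ULoop F)) (k : ℕ) :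
    ∃ i n U lam y, ((((𝔯.lit F θ hP g₀ os).ne2 k).Kop i).e n U lam y) ≠ 0 := by
  by_contra h
  push Not at h
  exact not_sizedPin_of_kop_zero 𝔯 h hpin

end Reading

end Summit.QuantumFields.YangMills.BalabanUVNodes.N15.SizedNonVanishing
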